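import Literature.IUT.HodgeTheaters.PiAvatarLocalLabels
import Literature.IUT.HodgeTheaters.PiAvatarNFKitSlots
import HarnessLib

/-!
# [IUTchI] Def 6.1 (iii): the LOCAL ARROW LAW (L2) `sign` of abc-iut-L5-t4's `LocalArrowLaw` — automorphisms of `𝒟_v̲`
# act on the label chart by `±1` — DERIVED from the ramification of `X̲→ → X̲` (proof-only; post-freeze additive D13 piece)

S. Mochizuki, *Inter-universal Teichmüller theory I*, kurims manuscript (May 2020), §6 Def 6.1 (iii) p. 157 l. 8–9 «we
obtain a natural surjection `Aut(†𝒟_v) ↠ {±1}` … by considering the induced automorphism of [the `𝔽_l^±`-group]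
`LabCusp^±(†𝒟_v)`», with §1 pp. 37–38 (the construction of `X̲→`: «`Δ_X̲ ↠ Δ_ε`» kills the inertia of the nonzero
cusps `≠ ε′, ε″`; `I_{ε′} ⥲ Δ_ε⁺`, `I_{ε″} ⥲ Δ_ε⁺`) and Rmk 1.1.2 [cite: Mochizuki2012, Def 6.1(iii) p.157; §1 pp.37-38]
(D-0012 claim key; series DISPUTED — this file is finite group theory and arithmetic mod `l` over abc-iut-L5-t2's REAL
`InitialThetaData`, abc-iut-L5-t1's CONSTRUCTION `PuncturedEllipticData.jKer`/`piXarrow` with its printed claims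
`ArrowCoveringClaims`, and abc-iut-L5-t4's DERIVED cusp action `actF` / chart `gChart₀Model` / affineness
`gChart₀Model_actF` and abc-iut-L5-t3's `gChart₀Model_ε2`; nothing of the series is asserted; no side is taken on [IUTchIII] Cor. 3.12).

WHAT (abc-iut-L5-lead gen 6 RULINGS #63 (2) «d5 NEXT = GO (L2) sign»; GAP-LEDGER G-L5t4g4-1).  The field
**(L2) `sign : ∀ n ∈ N(H), ∀ hn : n ∈ N(Π_{X̲_K}), ∃ ε : ℤˣ, ∀ x, gChart₀ (actF ⟨n, hn⟩ x) = ε • gChart₀ x`** of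
`InitialThetaData.LocalArrowLaw CG hS H` (`PiAvatarLocalLabels.lean`, p440701) is PROVED — with NO input beyond the standing
§1 binder `hA : D.geom.pe.ArrowCoveringClaims` (and t4's interface data `CG`, `hS`) — for EVERY subgroup `H` whose
normaliser normalises `embK(jKer) = embK(Δ_{X̲→})`, in particular for the local groups `Π_v̲ = Π_{X̲→_K} ∩ augGF⁻¹(G_v̲)`
(`localArrowLaw_L2_sign_local`; `N(Π_v̲) ≤ N(Π_v̲ ∩ Δ_C) = N(embK jKer)`).  THE ARGUMENT (ramification, not [AbsTopI]):
(1) `inertia_le_jKer_of_ne` — every cusp `x ∉ {ε⁰, ε′, ε″}` has `I_x ≤ jKer` (the construction kills it), while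
`¬ I_{ε′} ≤ jKer`, `¬ I_{ε″} ≤ jKer` (`I_{ε′} ⊔ jKer = Δ_X̲` with `[Δ_X̲ : jKer] = l ≥ 5`): the cover `X̲→ → X̲` is
ramified at `ε′, ε″` and possibly at `ε⁰`, nowhere else; (2) `inertia_actF_le_jKer_iff` — an `n ∈ N(Π_{X̲_K})` normalising
`embK(jKer)` permutes the cusps PRESERVING «`I_x ≤ jKer`» (law (a) `actF_decomp`: `(t n)·embK(D_x)·(t n)⁻¹ = embK(D_{n·x})`,
intersected with the normal `Δ_C`; `t ∈ Π_{X̲_K}` normalises `embK(jKer)` by `ArrowCoveringClaims.jKer_normal`); (3) in the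
chart based at `ε⁰` (`gChart₀ ε⁰ = 0`, `ε′ ↦ 1`, `ε″ ↦ −1`) the action of `n` is AFFINE `z ↦ u z + b` (abc-iut-L5-t4's
`gChart₀Model_actF`, `u = actFSlope n ≠ 0`); so `u + b, −u + b ∈ {0, 1, −1}` and either `b ∈ {0, 1, −1}` with the three
values distinct (if `ε⁰` ramifies) or `u + b, −u + b ∈ {1, −1}` distinct (if not) — in both cases `3b = 0` resp. `2b = 0`,
hence `b = 0` (`l` prime `≥ 5`) and `u = ±1` (`actF_translation_eq_zero`, `actFSlope_eq_one_or_neg_one`); (4)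
`localArrowLaw_L2_sign` — `gChart₀ (n·x) = ε • gChart₀ x` with `ε = ±1 ∈ ℤˣ`.
EFFECT: with abc-iut-L5-d5's (L1) file `PiAvatarLocalArrowLawL1OfTorsionMonodromy` (p445209), BOTH Prop fields of
`LocalArrowLaw` at the local groups are theorems — the whole binder `Λ : D.LocalArrowLaw CG hS Π_v̲` is constructible from
`{M : TorsionMonodromy, hA, hI}` (assembly in the sequel file).  Proof-only (0 definitions, no instance, no notation);
axioms standard.  HONEST FRAMING: `hA` is an assumption label (printed §1 claims), `CG`/`hS` interface data of
abc-iut-L5-t1 and abc-iut-L5-t4; typed ≠ inhabited ≠ discharged; nothing here bears on [IUTchIII] Cor. 3.12.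
-/

noncomputable section

namespace Literature.IUT.HodgeTheaters

open scoped Pointwise

universe u v w

variable {F : Type u} {K : Type v} {Fbar : Type w} [Field F] [NumberField F] [Field K] [NumberField K]
  [Algebra F K] [Field Fbar] [Algebra F Fbar] [Algebra K Fbar]
  {E : WeierstrassCurve F} [E.IsElliptic] {l : ℕ} {Pb : BadPlacePredicates K}

/-! ### §0. Arithmetic mod `l`: small combinatorics in the chart `{0, 1, −1}` -/

section ModL

/-- `(m : ZMod l) ≠ 0` for `0 < m < 5 ≤ l`. [folklore] -/
private theorem l2_natCast_ne_zero {l : ℕ} (h5 : 5 ≤ l) {m : ℕ} (hm0 : 0 < m) (hm : m < 5) : (m : ZMod l) ≠ 0 := by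
  rw [Ne, ZMod.natCast_eq_zero_iff]
  intro hdvd
  have := Nat.le_of_dvd hm0 hdvd
  omega

/-- Three DISTINCT elements of `{0, 1, −1}` sum to `0` (they are a permutation of `0, 1, −1`). [folklore] -/
private theorem l2_sum_eq_zero_of_distinct {R : Type*} [CommRing R] {a b c : R}
    (ha : a = 0 ∨ a = 1 ∨ a = -1) (hb : b = 0 ∨ b = 1 ∨ b = -1) (hc : c = 0 ∨ c = 1 ∨ c = -1)
    (hab : a ≠ b) (hac : a ≠ c) (hbc : b ≠ c) : a + b + c = 0 := by
  rcases ha with rfl | rfl | rfl <;> rcases hb with rfl | rfl | rfl <;> rcases hc with rfl | rfl | rfl <;>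
    first | exact absurd rfl hab | exact absurd rfl hac | exact absurd rfl hbc | ring

/-- Two DISTINCT elements of `{1, −1}` sum to `0`. [folklore] -/
private theorem l2_sum_eq_zero_of_distinct_two {R : Type*} [CommRing R] {a b : R}
    (ha : a = 1 ∨ a = -1) (hb : b = 1 ∨ b = -1) (hab : a ≠ b) : a + b = 0 := by
  rcases ha with rfl | rfl <;> rcases hb with rfl | rfl <;> first | exact absurd rfl hab | ring

end ModL

namespace InitialThetaData

variable (D : InitialThetaData F K Fbar E l Pb) (CG : D.geom.pe.CuspGalois) (hS : D.CuspClassesNormaliserStable)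

/-! ### §1. Ramification of `X̲→ → X̲`: which cusps have their inertia in `jKer = Δ_{X̲→}` -/

/-- **The construction kills the inertia of every nonzero cusp `≠ ε′, ε″`**: `I_x ≤ jKer` for `x ∉ {ε⁰, ε′, ε″}`
(`jKer ⊇ Ker(Δ_X̲ ↠ Δ_ε) ⊇ I_x`, [IUTchI] §1 p.37). ([IUTchI] §1 p.37) [claim: Mochizuki2012, status: disputed] -/
theorem inertia_le_jKer_of_ne {x : D.geom.pe.Cusp} (h0 : x ≠ D.geom.pe.ε0) (h1 : x ≠ D.geom.pe.ε1)
    (h2 : x ≠ D.geom.pe.ε2) : D.geom.pe.inertia x ≤ D.geom.pe.jKer := by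
  have h : D.geom.pe.inertia x ≤ D.geom.pe.deltaEpsKer := by
    refine le_trans ?_ (le_sup_right : _ ≤ D.geom.pe.modLKer ⊔ _)
    exact le_iSup (fun y : {y : D.geom.pe.Cusp // D.geom.pe.IsNonzeroCusp y ∧ y ≠ D.geom.pe.ε1 ∧ y ≠ D.geom.pe.ε2} =>
      D.geom.pe.inertia y.1) ⟨x, h0, h1, h2⟩
  exact le_trans h le_sup_left

variable {D}

/-- **`X̲→ → X̲` is ramified at `ε′`**: `¬ I_{ε′} ≤ jKer` (else `Δ_X̲ = I_{ε′} ⊔ jKer = jKer`, contradicting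
`[Δ_X̲ : jKer] = l ≥ 5`). ([IUTchI] §1 p.38) [claim: Mochizuki2012, status: disputed] -/
theorem not_inertia_ε1_le_jKer (hA : D.geom.pe.ArrowCoveringClaims) :
    ¬ D.geom.pe.inertia D.geom.pe.ε1 ≤ D.geom.pe.jKer := by
  intro hle
  have heq : D.geom.pe.jKer = D.geom.pe.DeltaXbar := by
    rw [← hA.inertia_ε1_sup]; exact (sup_eq_right.mpr hle).symm
  have h1 : D.geom.pe.jKer.relIndex D.geom.pe.DeltaXbar = 1 := by rw [heq, Subgroup.relIndex_self]
  have h5 := D.geom.pe.five_le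
  rw [hA.jKer_relindex] at h1
  omega

/-- **`X̲→ → X̲` is ramified at `ε″`**: `¬ I_{ε″} ≤ jKer`. ([IUTchI] §1 p.38) [claim: Mochizuki2012, status: disputed] -/
theorem not_inertia_ε2_le_jKer (hA : D.geom.pe.ArrowCoveringClaims) :
    ¬ D.geom.pe.inertia D.geom.pe.ε2 ≤ D.geom.pe.jKer := by
  intro hle
  have heq : D.geom.pe.jKer = D.geom.pe.DeltaXbar := by
    rw [← hA.inertia_ε2_sup]; exact (sup_eq_right.mpr hle).symm
  have h1 : D.geom.pe.jKer.relIndex D.geom.pe.DeltaXbar = 1 := by rw [heq, Subgroup.relIndex_self]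
  have h5 := D.geom.pe.five_le
  rw [hA.jKer_relindex] at h1
  omega

/-- A cusp whose inertia is NOT in `jKer` is one of `ε⁰, ε′, ε″`. ([IUTchI] §1 p.37) [claim: Mochizuki2012, status: disputed] -/
theorem mem_three_of_not_inertia_le_jKer {x : D.geom.pe.Cusp} (hx : ¬ D.geom.pe.inertia x ≤ D.geom.pe.jKer) :
    x = D.geom.pe.ε0 ∨ x = D.geom.pe.ε1 ∨ x = D.geom.pe.ε2 := by
  by_contra h
  push Not at h
  exact hx (D.inertia_le_jKer_of_ne h.1 h.2.1 h.2.2)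

/-! ### §2. `embK(I_x)` and its transport under the cusp action of `N(Π_{X̲_K})` -/

/-- `embK(D_x) ∩ Δ_C = embK(I_x)` inside `Π_{C_F}` (t2's `aug_compat`: an element of `Π_{C_K}` lies over `1 ∈ G_F` iff it lies
over `1 ∈ G_K`). ([IUTchI] Def 3.1 (d) p.62) [claim: Mochizuki2012, status: disputed] -/
theorem map_decomp_inf_DeltaC (x : D.geom.pe.Cusp) :
    (D.geom.pe.decomp x).map D.geom.embK ⊓ D.DeltaC = (D.geom.pe.inertia x).map D.geom.embK := by
  ext y
  constructor
  · rintro ⟨⟨d, hd, rfl⟩, hyΔ⟩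
    refine ⟨d, ⟨hd, ?_⟩, rfl⟩
    have h1 : D.geom.extF.aug (D.geom.embK d) = 1 := hyΔ
    have h2 := D.geom.aug_compat d
    rw [h1, map_one] at h2
    have h3 : (D.geom.galKIso (D.geom.pe.E.aug d) : galoisSubgroupOf F K Fbar) = 1 := Subtype.ext h2.symm
    have h4 := congrArg D.geom.galKIso.symm h3
    rw [MulEquiv.symm_apply_apply, map_one] at h4
    exact h4
  · rintro ⟨d, ⟨hd, hdΔ⟩, rfl⟩
    refine ⟨⟨d, hd, rfl⟩, ?_⟩
    have h1 : D.geom.pe.E.aug d = 1 := hdΔ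
    have h2 := D.geom.aug_compat d
    rw [h1, map_one, Subgroup.coe_one] at h2
    change D.geom.extF.aug (D.geom.embK d) = 1
    have := congrArg D.geom.galIso.symm h2
    rwa [MulEquiv.symm_apply_apply, map_one] at this

/-- Conjugation by an element of `P` fixes a subgroup `N ≤ P` that is normal IN `P` (plumbing). [folklore] -/
private theorem l2_conj_smul_eq_of_normal_subgroupOf {G : Type*} [Group G] {N P : Subgroup G} (hNP : N ≤ P)
    (hN : (N.subgroupOf P).Normal) {g : G} (hg : g ∈ P) : MulAut.conj g • N = N := by
  have key : ∀ (a : G), a ∈ P → ∀ z ∈ N, a * z * a⁻¹ ∈ N := by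
    intro a ha z hz
    have h := hN.conj_mem ⟨z, hNP hz⟩ (Subgroup.mem_subgroupOf.mpr hz) ⟨a, ha⟩
    exact Subgroup.mem_subgroupOf.mp h
  ext z
  rw [Subgroup.mem_pointwise_smul_iff_inv_smul_mem, MulAut.smul_def, MulAut.conj_inv_apply]
  constructor
  · intro hz
    have h := key g hg _ hz
    have : g * (g⁻¹ * z * g) * g⁻¹ = z := by group
    rwa [this] at h
  · intro hz
    have h := key g⁻¹ (inv_mem hg) z hz
    rwa [inv_inv] at h

/-- Elements of `Π_{X̲_K} = embK(Π_X̲)` normalise `embK(jKer)` (`jKer ⊴ Π_C̲ ⊇ Π_X̲`, `ArrowCoveringClaims.jKer_normal`).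
([IUTchI] §1 p.38) [claim: Mochizuki2012, status: disputed] -/
theorem conj_smul_map_jKer_of_mem_PiXund (hA : D.geom.pe.ArrowCoveringClaims) {t : D.PiC} (ht : t ∈ D.PiXund) :
    MulAut.conj t • D.geom.pe.jKer.map D.geom.embK = D.geom.pe.jKer.map D.geom.embK := by
  obtain ⟨t', ht', rfl⟩ := Subgroup.mem_map.mp ht
  have hjC : D.geom.pe.jKer ≤ D.geom.pe.PiCbar :=
    le_trans (le_trans (le_sup_right : D.geom.pe.jKer ≤ D.geom.pe.piXarrow) D.geom.pe.piXarrow_le_piXbar) inf_le_right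
  rw [D.conj_embK_smul_map, l2_conj_smul_eq_of_normal_subgroupOf hjC hA.jKer_normal ht'.2]

/-- **Transport of ramification under the cusp action**: for `n ∈ N(Π_{X̲_K})` normalising `embK(jKer)`,
`I_{n·x} ≤ jKer ↔ I_x ≤ jKer` (law (a) `actF_decomp` intersected with the normal subgroup `Δ_C`).
([IUTchI] Def 6.1 (iii) p.157) [claim: Mochizuki2012, status: disputed] -/
theorem inertia_actF_le_jKer_iff (hA : D.geom.pe.ArrowCoveringClaims)
    (n : ↥(Subgroup.normalizer ((D.PiXund : Subgroup D.PiC) : Set D.PiC)))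
    (hnj : MulAut.conj (n : D.PiC) • D.geom.pe.jKer.map D.geom.embK = D.geom.pe.jKer.map D.geom.embK)
    (x : D.geom.pe.Cusp) :
    D.geom.pe.inertia (D.actF CG hS n x) ≤ D.geom.pe.jKer ↔ D.geom.pe.inertia x ≤ D.geom.pe.jKer := by
  haveI : D.DeltaC.Normal := inferInstanceAs D.geom.extF.geom.Normal
  obtain ⟨t, ht, hconj⟩ := D.actF_decomp CG hS n x
  -- conjugate `embK(D_x) ∩ Δ_C = embK(I_x)` by `t n`
  have hI : MulAut.conj (t * (n : D.PiC)) • (D.geom.pe.inertia x).map D.geom.embK =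
      (D.geom.pe.inertia (D.actF CG hS n x)).map D.geom.embK := by
    rw [← map_decomp_inf_DeltaC, ← map_decomp_inf_DeltaC, Subgroup.smul_inf, hconj,
      Subgroup.Normal.conj_smul_eq_self]
  have hJ : MulAut.conj (t * (n : D.PiC)) • D.geom.pe.jKer.map D.geom.embK = D.geom.pe.jKer.map D.geom.embK := by
    rw [map_mul, mul_smul, hnj, conj_smul_map_jKer_of_mem_PiXund hA ht]
  rw [← Subgroup.map_le_map_iff_of_injective D.geom.embK_injective, ← hI,
    ← Subgroup.map_le_map_iff_of_injective (f := D.geom.embK) D.geom.embK_injective (H := D.geom.pe.inertia x),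
    ← hJ, Subgroup.pointwise_smul_le_pointwise_smul_iff, hJ]

/-! ### §3. The affine map `z ↦ u z + b` of `n` preserves the ramification locus: `b = 0`, `u = ±1` -/

variable [Fact l.Prime]

/-- In the chart, a cusp among `ε⁰, ε′, ε″` has label `0`, `1` or `−1`. ([IUTchI] §1 p.37) [claim: Mochizuki2012, status: disputed] -/
theorem gChart₀Model_mem_three {x : D.geom.pe.Cusp} (hx : x = D.geom.pe.ε0 ∨ x = D.geom.pe.ε1 ∨ x = D.geom.pe.ε2) :
    D.gChart₀Model CG x = 0 ∨ D.gChart₀Model CG x = 1 ∨ D.gChart₀Model CG x = -1 := by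
  rcases hx with rfl | rfl | rfl
  · exact Or.inl (D.gChart₀Model_ε0 CG)
  · exact Or.inr (Or.inl (D.gChart₀Model_ε1 CG))
  · exact Or.inr (Or.inr (D.gChart₀Model_ε2 CG))

/-- **The translation part vanishes and the slope is `±1`**: for `n ∈ N(Π_{X̲_K})` normalising `embK(jKer)`,
`actF n ε⁰ = ε⁰`-in-the-chart (`gChart₀ (n·ε⁰) = 0`) and `actFSlope n = ±1` — the affine map `z ↦ u z + b` permutes
the labels `{1, −1}` (or `{0, 1, −1}`) of the ramified cusps, so `2b = 0` (or `3b = 0`) and `u ∈ {1, −1}` (`l` prime `≥ 5`).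
([IUTchI] Def 6.1 (iii) p.157) [claim: Mochizuki2012, status: disputed] -/
theorem actF_translation_eq_zero_and_slope (hA : D.geom.pe.ArrowCoveringClaims)
    (n : ↥(Subgroup.normalizer ((D.PiXund : Subgroup D.PiC) : Set D.PiC)))
    (hnj : MulAut.conj (n : D.PiC) • D.geom.pe.jKer.map D.geom.embK = D.geom.pe.jKer.map D.geom.embK) :
    D.gChart₀Model CG (D.actF CG hS n D.geom.pe.ε0) = 0 ∧
      (D.actFSlope CG hS n = 1 ∨ D.actFSlope CG hS n = -1) := by
  have h5 : 5 ≤ l := by rw [← D.geom.pe_l]; exact D.geom.pe.five_le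
  have h2ne : (2 : ZMod l) ≠ 0 := by exact_mod_cast l2_natCast_ne_zero h5 (m := 2) (by norm_num) (by norm_num)
  have h3ne : (3 : ZMod l) ≠ 0 := by exact_mod_cast l2_natCast_ne_zero h5 (m := 3) (by norm_num) (by norm_num)
  set e := D.gChart₀Model CG with he
  set u := D.actFSlope CG hS n with hu
  set b := e (D.actF CG hS n D.geom.pe.ε0) with hb
  have hu0 : u ≠ 0 := D.actFSlope_ne_zero CG hS n
  -- the images of the ramified cusps `ε′, ε″` are ramified, hence among `ε⁰, ε′, ε″`
  have hP := D.inertia_actF_le_jKer_iff CG hS hA n hnj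
  have hr1 : ¬ D.geom.pe.inertia (D.actF CG hS n D.geom.pe.ε1) ≤ D.geom.pe.jKer :=
    fun h => not_inertia_ε1_le_jKer hA ((hP _).mp h)
  have hr2 : ¬ D.geom.pe.inertia (D.actF CG hS n D.geom.pe.ε2) ≤ D.geom.pe.jKer :=
    fun h => not_inertia_ε2_le_jKer hA ((hP _).mp h)
  have hv1 := D.gChart₀Model_mem_three CG (mem_three_of_not_inertia_le_jKer hr1)
  have hv2 := D.gChart₀Model_mem_three CG (mem_three_of_not_inertia_le_jKer hr2)
  -- the affine formula at `ε′ ↦ 1`, `ε″ ↦ −1`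
  have hf1 : e (D.actF CG hS n D.geom.pe.ε1) = u + b := by
    rw [he, D.gChart₀Model_actF CG hS n, D.gChart₀Model_ε1 CG, mul_one]
  have hf2 : e (D.actF CG hS n D.geom.pe.ε2) = -u + b := by
    rw [he, D.gChart₀Model_actF CG hS n, D.gChart₀Model_ε2 CG, mul_neg, mul_one]
  rw [hf1] at hv1
  rw [hf2] at hv2
  have hne12 : u + b ≠ -u + b := by
    intro h
    apply hu0
    have : (2 : ZMod l) * u = 0 := by linear_combination h
    rcases mul_eq_zero.mp this with h2 | h2
    · exact absurd h2 h2ne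
    · exact h2
  -- first `b = 0`
  have hb0 : b = 0 := by
    by_cases hε0 : D.geom.pe.inertia D.geom.pe.ε0 ≤ D.geom.pe.jKer
    · -- `ε⁰` unramified: the ramified images avoid `ε⁰`, so `u + b, −u + b ∈ {1, −1}`
      have hn1 : u + b ≠ 0 := by
        intro h0
        have : D.actF CG hS n D.geom.pe.ε1 = D.geom.pe.ε0 :=
          e.injective (by rw [hf1, h0, he, D.gChart₀Model_ε0 CG])
        exact hr1 (this ▸ hε0)
      have hn2 : -u + b ≠ 0 := by
        intro h0
        have : D.actF CG hS n D.geom.pe.ε2 = D.geom.pe.ε0 :=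
          e.injective (by rw [hf2, h0, he, D.gChart₀Model_ε0 CG])
        exact hr2 (this ▸ hε0)
      have hv1' : u + b = 1 ∨ u + b = -1 := by rcases hv1 with h | h <;> [exact absurd h hn1; exact h]
      have hv2' : -u + b = 1 ∨ -u + b = -1 := by rcases hv2 with h | h <;> [exact absurd h hn2; exact h]
      have hsum := l2_sum_eq_zero_of_distinct_two hv1' hv2' hne12
      have : (2 : ZMod l) * b = 0 := by linear_combination hsum
      rcases mul_eq_zero.mp this with h | h
      · exact absurd h h2ne
      · exact h
    · -- `ε⁰` ramified too: the three images are the three ramified cusps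
      have hr0 : ¬ D.geom.pe.inertia (D.actF CG hS n D.geom.pe.ε0) ≤ D.geom.pe.jKer :=
        fun h => hε0 ((hP _).mp h)
      have hv0 := D.gChart₀Model_mem_three CG (mem_three_of_not_inertia_le_jKer hr0)
      rw [← hb] at hv0
      have hinj : ∀ y z : D.geom.pe.Cusp, e (D.actF CG hS n y) = e (D.actF CG hS n z) → y = z :=
        fun y z h => (D.actF CG hS n).injective (e.injective h)
      have hne01 : b ≠ u + b := by
        intro h; rw [hb, ← hf1] at h; exact D.geom.pe.ε1_ne_ε0 (hinj _ _ h).symm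
      have hne02 : b ≠ -u + b := by
        intro h; rw [hb, ← hf2] at h; exact D.geom.pe.ε2_ne_ε0 (hinj _ _ h).symm
      have hsum := l2_sum_eq_zero_of_distinct hv0 hv1 hv2 hne01 hne02 hne12
      have : (3 : ZMod l) * b = 0 := by linear_combination hsum
      rcases mul_eq_zero.mp this with h | h
      · exact absurd h h3ne
      · exact h
  refine ⟨hb0, ?_⟩
  rw [hb0, add_zero] at hv1
  rcases hv1 with h | h | h
  · exact absurd h hu0
  · exact Or.inl h
  · exact Or.inr (by linear_combination h)

/-! ### §4. The local arrow law (L2) `sign` -/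

/-- **(L2) [IUTchI] Def 6.1 (iii) «`Aut(†𝒟_v) ↠ {±1}` … by considering the induced automorphism of `LabCusp^±(†𝒟_v)`»,
DERIVED**: an element `n ∈ N(Π_{X̲_K})` normalising `embK(jKer) = embK(Δ_{X̲→})` acts on the cusps of `X̲_K` by `z ↦ ±z` in
the chart based at `ε⁰` — from the printed §1 claims `hA` alone (ramification of `X̲→ → X̲` at exactly `ε′, ε″` [and `ε⁰`]
+ abc-iut-L5-t4's affineness of the derived action). ([IUTchI] Def 6.1(iii) p.157) [claim: Mochizuki2012, status: disputed] -/
theorem localArrowLaw_L2_sign_of_normalizes_jKer (hA : D.geom.pe.ArrowCoveringClaims) (n : D.PiC)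
    (hnj : MulAut.conj n • D.geom.pe.jKer.map D.geom.embK = D.geom.pe.jKer.map D.geom.embK)
    (hn : n ∈ Subgroup.normalizer ((D.PiXund : Subgroup D.PiC) : Set D.PiC)) :
    ∃ ε : ℤˣ, ∀ x, D.gChart₀Model CG (D.actF CG hS ⟨n, hn⟩ x) = ε • D.gChart₀Model CG x := by
  obtain ⟨hb, hu⟩ := D.actF_translation_eq_zero_and_slope CG hS hA ⟨n, hn⟩ hnj
  rcases hu with hu | hu
  · refine ⟨1, fun x => ?_⟩
    rw [D.gChart₀Model_actF CG hS, hb, hu, one_mul, add_zero, one_smul]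
  · refine ⟨-1, fun x => ?_⟩
    rw [D.gChart₀Model_actF CG hS, hb, hu, add_zero, Units.neg_smul, one_smul, neg_one_mul]

omit [Fact l.Prime] in
/-- For a subgroup `H` with `H ∩ Δ_C = embK(jKer)`, every `n ∈ N(H)` normalises `embK(jKer)` (`Δ_C ⊴ Π_{C_F}`).
([IUTchI] Def 3.1 (f) p.63) [claim: Mochizuki2012, status: disputed] -/
theorem conj_smul_map_jKer_of_mem_normalizer {H : Subgroup D.PiC} (hH : H ⊓ D.DeltaC = D.geom.pe.jKer.map D.geom.embK)
    {n : D.PiC} (hn : n ∈ Subgroup.normalizer ((H : Subgroup D.PiC) : Set D.PiC)) :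
    MulAut.conj n • D.geom.pe.jKer.map D.geom.embK = D.geom.pe.jKer.map D.geom.embK := by
  haveI : D.DeltaC.Normal := inferInstanceAs D.geom.extF.geom.Normal
  have hH' : MulAut.conj n • H = H := by
    ext z
    rw [Subgroup.mem_pointwise_smul_iff_inv_smul_mem, MulAut.smul_def, MulAut.conj_inv_apply]
    have := (Subgroup.mem_normalizer_iff.mp (inv_mem hn) z)
    rw [inv_inv] at this
    exact this.symm
  rw [← hH, Subgroup.smul_inf, hH', Subgroup.Normal.conj_smul_eq_self]

omit [Fact l.Prime] in
/-- `Π_v̲ ∩ Δ_C = embK(jKer)` for the local groups `Π_v̲ = Π_{X̲→_K} ∩ augGF⁻¹(G_v̲)` (the cartesian claim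
`Π_{X̲→} ∩ Δ_C = jKer` of §1 p.38 pushed along `embK`; `Δ_C ≤ augGF⁻¹(G_v̲)`). ([IUTchI] §1 p.38) [claim: Mochizuki2012, status: disputed] -/
theorem local_inf_DeltaC (hA : D.geom.pe.ArrowCoveringClaims) (Gv : Subgroup (Fbar ≃ₐ[F] Fbar)) :
    (D.PiXarrow ⊓ Gv.comap D.augGF) ⊓ D.DeltaC = D.geom.pe.jKer.map D.geom.embK := by
  have hΔG : D.DeltaC ≤ Gv.comap D.augGF := by
    intro k hk
    rw [Subgroup.mem_comap]
    have hk1 : D.geom.extF.aug k = 1 := hk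
    have : D.augGF k = 1 := by
      change D.geom.galIso (D.geom.extF.aug k) = 1
      rw [hk1, map_one]
    rw [this]; exact one_mem _
  have h1 : (D.PiXarrow ⊓ Gv.comap D.augGF) ⊓ D.DeltaC = D.PiXarrow ⊓ D.DeltaC := by
    rw [inf_assoc, inf_eq_right.mpr hΔG]
  rw [h1, ← hA.piXarrow_inf_delta]
  -- `embK(Π_{X̲→}) ∩ Δ_C = embK(Π_{X̲→} ∩ Δ_{C_K})`
  ext y
  constructor
  · rintro ⟨⟨d, hd, rfl⟩, hyΔ⟩
    refine ⟨d, ⟨hd, ?_⟩, rfl⟩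
    have h1 : D.geom.extF.aug (D.geom.embK d) = 1 := hyΔ
    have h2 := D.geom.aug_compat d
    rw [h1, map_one] at h2
    have h3 : (D.geom.galKIso (D.geom.pe.E.aug d) : galoisSubgroupOf F K Fbar) = 1 := Subtype.ext h2.symm
    have h4 := congrArg D.geom.galKIso.symm h3
    rw [MulEquiv.symm_apply_apply, map_one] at h4
    exact h4
  · rintro ⟨d, ⟨hd, hdΔ⟩, rfl⟩
    refine ⟨⟨d, hd, rfl⟩, ?_⟩
    have h1 : D.geom.pe.E.aug d = 1 := hdΔ
    have h2 := D.geom.aug_compat d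
    rw [h1, map_one, Subgroup.coe_one] at h2
    change D.geom.extF.aug (D.geom.embK d) = 1
    have := congrArg D.geom.galIso.symm h2
    rwa [MulEquiv.symm_apply_apply, map_one] at this

/-- **(L2) at the LOCAL GROUPS `Π_v̲ = Π_{X̲→_K} ∩ augGF⁻¹(G_v̲)`** (every subgroup `G_v̲ ≤ G_F`): the field `sign` of
`D.LocalArrowLaw CG hS (D.PiXarrow ⊓ Gv.comap D.augGF)` VERBATIM, from the printed §1 claims `hA` alone.
([IUTchI] Def 6.1(iii) p.157) [claim: Mochizuki2012, status: disputed] -/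
theorem localArrowLaw_L2_sign_local (hA : D.geom.pe.ArrowCoveringClaims) (Gv : Subgroup (Fbar ≃ₐ[F] Fbar)) :
    ∀ n : D.PiC, n ∈ Subgroup.normalizer (((D.PiXarrow ⊓ Gv.comap D.augGF : Subgroup D.PiC)) : Set D.PiC) →
      ∀ hn : n ∈ Subgroup.normalizer ((D.PiXund : Subgroup D.PiC) : Set D.PiC),
        ∃ ε : ℤˣ, ∀ x, D.gChart₀Model CG (D.actF CG hS ⟨n, hn⟩ x) = ε • D.gChart₀Model CG x :=
  fun n hnH hn => D.localArrowLaw_L2_sign_of_normalizes_jKer CG hS hA n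
    (conj_smul_map_jKer_of_mem_normalizer (D.local_inf_DeltaC hA Gv) hnH) hn

end InitialThetaData

end Literature.IUT.HodgeTheaters

end
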